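import Literature.Computability.Complexity.HashBucketConcentration
import Mathlib.Algebra.Order.BigOperators.Ring.Finset
import Mathlib.Data.Int.CardIntervalMod
import Mathlib.Data.Nat.Count
import Mathlib.Data.Nat.Cast.Order.Field
import Mathlib.Tactic.FieldSimp
import Mathlib.Tactic.Linarith
import Mathlib.Tactic.Positivity
import Mathlib.Tactic.Ring
import HarnessLib

/-!
# Private selection from a hashed bucket is nearly uniform on the whole set

Trunk T-CPLX-CORE, continuation of `HashBucketConcentration.lean` (the moments of the bucket
`targetBucket S h y = S ∩ h⁻¹(y)` of a finite `S ⊆ 𝔽₂ᵐ` under a uniformly random affine hash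
`h : 𝔽₂ᵐ → 𝔽₂ᵏ`). App. D campaign (design v3), part P2, of the discharge of
`Literature.Barriers.PneNP.AkaviaEtAl2006_complMemIPk` (Akavia–Goldreich–Goldwasser–Moshkovitz,
STOC 2006, App. D), but generic and independent of it.

**The device.** A verifier that cannot enumerate a huge certifiable set `S` (here: the preimages
`f⁻¹(y)` of a query) but wants the prover's answer to behave like a UNIFORMLY RANDOM element of `S`
sends a random hash `h` with `|S|/2ᵏ = μ` moderately large, lets the prover list the bucket
`S ∩ h⁻¹(0)` (a set of expected size `μ`, small enough to list and to certify element-wise), and then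
PRIVATELY picks the answer from the list by an independent uniform index `u ∈ {0, …, D-1}` reduced
modulo the list length (`pick`). AGGM (§2.1, printed pp. 7–8) let the answer be the smallest listed
element and police omissions by size statistics; with a private index an omitted FRACTION `φ` of
the bucket moves the law of the answer by only `O(φ)` in total variation (`sum_abs_pickCount_sub_le`),
and for the FULL bucket the law of the answer, averaged over `h`, dominates the uniform law on `S`
up to the factor `1 - 1/μ - μ/D` (`card_pick_targetBucket_ge`). The heart is the Cauchy–Schwarz
estimate `sum_inv_card_targetBucket_ge`: for `x ∈ S`,
`Σ_{h : h(x) = y} 1/|S ∩ h⁻¹(y)| ≥ |ℋ| / (2ᵏ + |S| - 1)`, from one-point uniformity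
(`#{h | h(x) = y} = |ℋ|/2ᵏ`) and pairwise independence (`Σ_{h : h(x)=y} |bucket| = |ℋ|/2ᵏ ·
(1 + (|S|-1)/2ᵏ)`, `sum_card_targetBucket_mem`) by Sedrakyan's form of Cauchy–Schwarz
(`Finset.sq_sum_div_le_sum_sq_div`).

Contents: `sum_card_targetBucket_mem`, `sum_inv_card_targetBucket_ge` (hashing); in the sub-namespace
`BucketSelection`: `pick`,
`pickCount`, `pickCount_eq_zero_of_not_mem`, `le_pickCount`/`pickCount_le` (`⌊D/ℓ⌋ ≤ # ≤ ⌊D/ℓ⌋ + 1`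
for a duplicate-free list of length `ℓ`, via `Nat.count_modEq_card`), `sum_pickCount`,
`sum_abs_pickCount_sub_le` (sub-list versus list: `Σ_o |#_L(o) - #_B(o)| ≤ 2D(1 - |L|/|B|) + 2|B|`),
`pickCount_eq_card` (any decidability instance);
`card_pick_targetBucket_ge` (the `h`-averaged domination, counting form over `ℋ × Fin D`).
Mathlib + the two hashing files only, all proved, no named facts.

## References

* A. Akavia, O. Goldreich, S. Goldwasser, D. Moshkovitz, *On basing one-way functions on
  NP-hardness*, STOC 2006 (held preprint), §2.1 (printed pp. 7–8: hashed buckets of preimages,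
  "the prover may omit a few members … at its choice"), App. D.
* S. Arora, B. Barak, *Computational Complexity: A Modern Approach*, CUP 2009, Def. 8.14,
  Thm. 8.15 (pairwise independent hashing).
* [folklore] Sedrakyan/Engel form of the Cauchy–Schwarz inequality.
-/

noncomputable section

namespace Literature.Computability.Complexity

open Finset

open scoped Classical

namespace AffineHash

variable {m k : ℕ}

/-! ### Buckets seen from a fixed member: first moment and the harmonic bound -/

/-- **The bucket of a member, first moment**: for `x ∈ S`, summed over the hash functions with
`h(x) = y`, the sizes of the bucket `S ∩ h⁻¹(y)` total `|ℋ|/2ᵏ + (|S| - 1)|ℋ|/4ᵏ` (the member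
itself by one-point uniformity, every other element by pairwise independence).
[cite: AroraBarakCC2009, Thm. 8.15] -/
theorem sum_card_targetBucket_mem (S : Finset (Fin m → ZMod 2)) {x : Fin m → ZMod 2} (hx : x ∈ S)
    (y : Fin k → ZMod 2) :
    ∑ h ∈ univ.filter (fun h : Hash m k => hash h x = y), ((targetBucket S h y).card : ℝ) =
      Fintype.card (Hash m k) / 2 ^ k +
        (S.card - 1 : ℝ) * (Fintype.card (Hash m k) / (2 ^ k * 2 ^ k)) := by
  -- write the bucket size as a sum of indicators and swap the sums
  have hswap : ∑ h ∈ univ.filter (fun h : Hash m k => hash h x = y),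
      ((targetBucket S h y).card : ℝ) =
      ∑ x' ∈ S, ∑ h : Hash m k, (if hash h x = y ∧ hash h x' = y then (1 : ℝ) else 0) := by
    rw [sum_filter]
    have : ∀ h : Hash m k, (if hash h x = y then ((targetBucket S h y).card : ℝ) else 0) =
        ∑ x' ∈ S, (if hash h x = y ∧ hash h x' = y then (1 : ℝ) else 0) := by
      intro h
      by_cases h1 : hash h x = y
      · simp only [h1, if_true, true_and, targetBucket, card_filter, Nat.cast_sum, Nat.cast_ite,
          Nat.cast_one, Nat.cast_zero]
      · simp [h1]
    rw [sum_congr rfl fun h _ => this h, sum_comm]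
  rw [hswap, ← Finset.add_sum_erase S _ hx]
  congr 1
  · -- the member itself
    have : ∑ h : Hash m k, (if hash h x = y ∧ hash h x = y then (1 : ℝ) else 0) =
        ((univ.filter fun h : Hash m k => hash h x = y).card : ℝ) := by
      rw [card_filter, Nat.cast_sum]
      refine sum_congr rfl fun h _ => ?_
      by_cases h1 : hash h x = y <;> simp [h1]
    rw [this, card_filter_hash_eq_real]
  · -- the other elements
    rw [show (S.card - 1 : ℝ) = ((S.erase x).card : ℝ) by
      rw [card_erase_of_mem hx, Nat.cast_sub (card_pos.2 ⟨x, hx⟩), Nat.cast_one]]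
    rw [← nsmul_eq_mul, ← sum_const]
    refine sum_congr rfl fun x' hx' => ?_
    have hne : x ≠ x' := fun h => (mem_erase.1 hx').1 h.symm
    rw [← card_filter_hash_pair_real hne y y, card_filter, Nat.cast_sum]
    refine sum_congr rfl fun h _ => ?_
    by_cases h1 : hash h x = y ∧ hash h x' = y <;> simp [h1]

/-- **The harmonic bound** (Cauchy–Schwarz): for `x ∈ S`,
`Σ_{h : h(x) = y} 1/|S ∩ h⁻¹(y)| ≥ |ℋ| / (2ᵏ + |S| - 1)`. With `μ = |S|/2ᵏ` this says that a
uniformly random element of the bucket of a uniformly random `h` equals `x` with probability at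
least `1/(2ᵏ + |S| - 1) ≥ (1 - 1/μ)/|S|`: the bucket-sampled element dominates the uniform law on
`S` up to the factor `1 - 1/μ`. [folklore] -/
theorem sum_inv_card_targetBucket_ge (S : Finset (Fin m → ZMod 2)) {x : Fin m → ZMod 2}
    (hx : x ∈ S) (y : Fin k → ZMod 2) :
    (Fintype.card (Hash m k) : ℝ) / (2 ^ k + S.card - 1) ≤
      ∑ h ∈ univ.filter (fun h : Hash m k => hash h x = y),
        (1 : ℝ) / (targetBucket S h y).card := by
  set T := univ.filter (fun h : Hash m k => hash h x = y) with hT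
  have hpos : ∀ h ∈ T, (0 : ℝ) < (targetBucket S h y).card := by
    intro h hh
    have hxB : x ∈ targetBucket S h y := by
      rw [mem_filter]; exact ⟨hx, (mem_filter.1 hh).2⟩
    exact_mod_cast card_pos.2 ⟨x, hxB⟩
  -- Sedrakyan: `(Σ_T 1)² / Σ_T |bucket| ≤ Σ_T 1/|bucket|`
  have hCS := Finset.sq_sum_div_le_sum_sq_div T (fun _ => (1 : ℝ)) hpos
  simp only [one_pow, sum_const, nsmul_eq_mul, mul_one] at hCS
  refine le_trans (le_of_eq ?_) hCS
  -- evaluate the left-hand side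
  have hTcard : (T.card : ℝ) = Fintype.card (Hash m k) / 2 ^ k := card_filter_hash_eq_real x y
  have hsum := sum_card_targetBucket_mem (k := k) S hx y
  rw [← hT] at hsum
  rw [hsum, hTcard]
  have h2 : (0 : ℝ) < 2 ^ k := by positivity
  have hH : (0 : ℝ) < Fintype.card (Hash m k) := by
    exact_mod_cast Fintype.card_pos
  have hS1 : (1 : ℝ) ≤ S.card := by exact_mod_cast card_pos.2 ⟨x, hx⟩
  have hden : (0 : ℝ) < 2 ^ k + S.card - 1 := by linarith
  have hX' : ((2 : ℝ) ^ k + S.card - 1) ≠ 0 := hden.ne'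
  have hne : (Fintype.card (Hash m k) : ℝ) / 2 ^ k +
      (S.card - 1 : ℝ) * (Fintype.card (Hash m k) / (2 ^ k * 2 ^ k)) ≠ 0 := by
    have : (0 : ℝ) ≤ (S.card - 1 : ℝ) * (Fintype.card (Hash m k) / (2 ^ k * 2 ^ k)) :=
      mul_nonneg (by linarith) (by positivity)
    have : (0 : ℝ) < (Fintype.card (Hash m k) : ℝ) / 2 ^ k := by positivity
    linarith
  rw [div_eq_div_iff hX' hne]
  field_simp
  ring

end AffineHash

/-! ### Picking a listed element by a private index -/

namespace BucketSelection

variable {α : Type*}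

/-- **Private selection**: the element of the list `L` at position `u mod |L|` (`none` for the
empty list). The verifier holds `u` privately and uniformly in `{0, …, D-1}`; the prover supplies
`L` without seeing `u`. [folklore] -/
def pick (L : List α) (u : ℕ) : Option α :=
  L[u % L.length]?

/-- The empty list yields no pick. [folklore] -/
@[simp] theorem pick_nil (u : ℕ) : pick ([] : List α) u = none := by
  simp [pick]

/-- On a nonempty list the pick is the element at `u mod |L|`. [folklore] -/
theorem pick_eq_some_getElem {L : List α} (hL : L ≠ []) (u : ℕ) :
    pick L u = some (L[u % L.length]'(Nat.mod_lt _ (List.length_pos_iff.2 hL))) := by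
  simp [pick, List.getElem?_eq_getElem (Nat.mod_lt _ (List.length_pos_iff.2 hL))]

/-- The pick is always a listed element. [folklore] -/
theorem mem_of_pick_eq_some {L : List α} {u : ℕ} {x : α} (h : pick L u = some x) : x ∈ L := by
  unfold pick at h
  exact List.mem_of_getElem? h

/-- A nonempty list always yields a pick. [folklore] -/
theorem pick_ne_none {L : List α} (hL : L ≠ []) (u : ℕ) : pick L u ≠ none := by
  rw [pick_eq_some_getElem hL]; exact Option.some_ne_none _

/-- **The law of the pick**, counting form: the number of indices `u < D` whose pick is `o`.
[folklore] -/
def pickCount (L : List α) (D : ℕ) (o : Option α) : ℕ :=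
  (univ.filter fun u : Fin D => pick L u = o).card

/-- Unlisted elements are never picked. [folklore] -/
theorem pickCount_eq_zero_of_not_mem {L : List α} {x : α} (hx : x ∉ L) (D : ℕ) :
    pickCount L D (some x) = 0 := by
  rw [pickCount, card_eq_zero, filter_eq_empty_iff]
  exact fun u _ h => hx (mem_of_pick_eq_some h)

/-- A nonempty list never picks `none`. [folklore] -/
theorem pickCount_none_eq_zero {L : List α} (hL : L ≠ []) (D : ℕ) : pickCount L D none = 0 := by
  rw [pickCount, card_eq_zero, filter_eq_empty_iff]
  exact fun u _ h => pick_ne_none hL u h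

/-- The empty list always picks `none`. [folklore] -/
theorem pickCount_nil_none (D : ℕ) : pickCount ([] : List α) D none = D := by
  simp [pickCount]

/-- The counts over all outcomes total `D` (every index picks something). [folklore] -/
theorem sum_pickCount [Fintype α] (L : List α) (D : ℕ) :
    ∑ o : Option α, pickCount L D o = D := by
  unfold pickCount
  rw [← card_eq_sum_card_fiberwise (s := (univ : Finset (Fin D))) (t := univ)
    (f := fun u : Fin D => pick L (u : ℕ)) fun _ _ => mem_univ _]
  exact Fintype.card_fin D

/-- A filter over `Fin D` by a property of the value is a filter over `range D`. [folklore] -/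
theorem card_filter_fin_eq_card_filter_range (D : ℕ) (P : ℕ → Prop) [DecidablePred P] :
    (univ.filter fun u : Fin D => P u).card = ((range D).filter P).card := by
  rw [← Nat.Iio_eq_range, ← Fin.map_valEmbedding_univ, filter_map, card_map]
  rfl

/-- For a duplicate-free nonempty list, picking the `i`-th element means `u ≡ i (mod |L|)`: the count
of such `u < D` is `⌊D/|L|⌋` or `⌊D/|L|⌋ + 1`. [folklore] -/
theorem pickCount_getElem {L : List α} (hN : L.Nodup) {i : ℕ} (hi : i < L.length) (D : ℕ) :
    pickCount L D (some L[i]) = D / L.length + if i % L.length < D % L.length then 1 else 0 := by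
  classical
  have hL : L ≠ [] := List.ne_nil_of_length_pos (lt_of_le_of_lt (Nat.zero_le _) hi)
  have hlen : 0 < L.length := List.length_pos_iff.2 hL
  -- `pick L u = some L[i] ↔ u % |L| = i`
  have hiff : ∀ u : ℕ, pick L u = some L[i] ↔ u % L.length = i := by
    intro u
    rw [pick_eq_some_getElem hL, Option.some_inj]
    exact ⟨fun h => hN.getElem_inj_iff.1 h, fun h => by simp only [h]⟩
  have hcount := Nat.count_modEq_card (b := D) hlen i
  rw [Nat.count_eq_card_filter_range] at hcount
  rw [← hcount, pickCount, card_filter_fin_eq_card_filter_range D fun u => pick L u = some L[i]]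
  congr 1
  refine filter_congr fun u _ => ?_
  rw [hiff, Nat.ModEq, Nat.mod_eq_of_lt hi]

/-- **Lower bound on the law of the pick**: every listed element of a duplicate-free list of length
`ℓ` is picked by at least `D/ℓ - 1` of the `D` indices. [folklore] -/
theorem le_pickCount {L : List α} (hN : L.Nodup) {x : α} (hx : x ∈ L) (D : ℕ) :
    (D : ℝ) / L.length - 1 ≤ pickCount L D (some x) := by
  classical
  obtain ⟨i, hi, rfl⟩ := List.getElem_of_mem hx
  rw [pickCount_getElem hN hi D]
  have hlen : (0 : ℝ) < L.length := by
    exact_mod_cast lt_of_le_of_lt (Nat.zero_le _) hi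
  have hdiv : (D : ℝ) / L.length - 1 ≤ ((D / L.length : ℕ) : ℝ) := by
    have := Nat.cast_div_le (m := D) (n := L.length) (α := ℝ)
    have h2 : (D : ℝ) / L.length < (D / L.length : ℕ) + 1 := by
      rw [div_lt_iff₀ hlen]
      have hlenN : 0 < L.length := lt_of_le_of_lt (Nat.zero_le _) hi
      have := Nat.lt_div_mul_add (a := D) hlenN
      calc (D : ℝ) < ((D / L.length * L.length + L.length : ℕ) : ℝ) := by exact_mod_cast this
        _ = ((D / L.length : ℕ) + 1) * (L.length : ℝ) := by push_cast; ring
    linarith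
  calc (D : ℝ) / L.length - 1 ≤ ((D / L.length : ℕ) : ℝ) := hdiv
    _ ≤ ((D / L.length + if i % L.length < D % L.length then 1 else 0 : ℕ) : ℝ) := by
        exact_mod_cast Nat.le_add_right _ _

/-- **Upper bound on the law of the pick**: no element is picked by more than `D/ℓ + 1` indices.
[folklore] -/
theorem pickCount_le {L : List α} (hN : L.Nodup) {x : α} (hx : x ∈ L) (D : ℕ) :
    (pickCount L D (some x) : ℝ) ≤ (D : ℝ) / L.length + 1 := by
  classical
  obtain ⟨i, hi, rfl⟩ := List.getElem_of_mem hx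
  rw [pickCount_getElem hN hi D]
  have hdiv : ((D / L.length : ℕ) : ℝ) ≤ (D : ℝ) / L.length := Nat.cast_div_le
  split_ifs <;> push_cast <;> linarith

/-- **Omitting a fraction `φ` of a list moves the law of the pick by `O(φ)`**: for duplicate-free
lists `L ⊆ B`, `B` nonempty, the `ℓ¹` distance between the two pick-laws (as counts out of `D`) is at
most `2D(1 - |L|/|B|) + 2|B|`. (The two lists may be ordered differently: only the counts per
element enter.) [folklore] -/
theorem sum_abs_pickCount_sub_le [Fintype α] {L B : List α} (hLN : L.Nodup) (hBN : B.Nodup)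
    (hLB : ∀ x ∈ L, x ∈ B) (hB : B ≠ []) (D : ℕ) :
    ∑ o : Option α, |(pickCount L D o : ℝ) - pickCount B D o| ≤
      2 * D * (1 - (L.length : ℝ) / B.length) + 2 * B.length := by
  classical
  have hBlen : (0 : ℝ) < B.length := by exact_mod_cast List.length_pos_iff.2 hB
  have hLle : L.length ≤ B.length := by
    have := List.Subperm.length_le (hLN.subperm hLB)
    exact this
  have hLleR : (L.length : ℝ) ≤ B.length := by exact_mod_cast hLle
  by_cases hL : L = []
  · -- the empty sub-list: its law is all on `none`, total distance `2D`
    subst hL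
    have h1 : ∑ o : Option α, |(pickCount ([] : List α) D o : ℝ) - pickCount B D o| ≤
        ∑ o : Option α, ((pickCount ([] : List α) D o : ℝ) + pickCount B D o) :=
      sum_le_sum fun o _ => abs_sub _ _ |>.trans (by
        rw [abs_of_nonneg (by positivity), abs_of_nonneg (by positivity)])
    refine h1.trans ?_
    rw [sum_add_distrib]
    have hs1 : ∑ o : Option α, (pickCount ([] : List α) D o : ℝ) = D := by
      exact_mod_cast sum_pickCount ([] : List α) D
    have hs2 : ∑ o : Option α, (pickCount B D o : ℝ) = D := by exact_mod_cast sum_pickCount B D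
    rw [hs1, hs2]
    simp only [List.length_nil, Nat.cast_zero, zero_div, sub_zero, mul_one]
    linarith
  have hLlen : (0 : ℝ) < L.length := by exact_mod_cast List.length_pos_iff.2 hL
  -- split the outcomes: `none` / listed in `L` / in `B ∖ L` / elsewhere
  have hterm : ∀ o : Option α, |(pickCount L D o : ℝ) - pickCount B D o| ≤
      (if ∃ x ∈ L, o = some x then (D : ℝ) / L.length - D / B.length + 2 else 0) +
        (if ∃ x ∈ B, x ∉ L ∧ o = some x then (D : ℝ) / B.length + 1 else 0) := by
    intro o
    rcases o with _ | x
    · rw [pickCount_none_eq_zero hL, pickCount_none_eq_zero hB]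
      simp
    · by_cases hxL : x ∈ L
      · have hxB : x ∈ B := hLB x hxL
        have e1 : (∃ x' ∈ L, some x = some x') := ⟨x, hxL, rfl⟩
        have e2 : ¬ ∃ x' ∈ B, x' ∉ L ∧ some x = some x' := by
          rintro ⟨x', _, hx'L, hxx'⟩; rw [Option.some_inj] at hxx'; exact hx'L (hxx' ▸ hxL)
        rw [if_pos e1, if_neg e2, add_zero]
        have a1 := le_pickCount hLN hxL D
        have a2 := pickCount_le hLN hxL D
        have b1 := le_pickCount hBN hxB D
        have b2 := pickCount_le hBN hxB D
        have hmono : (D : ℝ) / B.length ≤ D / L.length :=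
          div_le_div_of_nonneg_left (by positivity) hLlen hLleR
        rw [abs_le]; constructor <;> linarith
      · rw [pickCount_eq_zero_of_not_mem hxL]
        by_cases hxB : x ∈ B
        · have e1 : ¬ ∃ x' ∈ L, some x = some x' := by
            rintro ⟨x', hx'L, hxx'⟩; rw [Option.some_inj] at hxx'; exact hxL (hxx' ▸ hx'L)
          have e2 : ∃ x' ∈ B, x' ∉ L ∧ some x = some x' := ⟨x, hxB, hxL, rfl⟩
          rw [if_neg e1, if_pos e2, zero_add, Nat.cast_zero, zero_sub, abs_neg,
            abs_of_nonneg (by positivity)]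
          exact pickCount_le hBN hxB D
        · have e1 : ¬ ∃ x' ∈ L, some x = some x' := by
            rintro ⟨x', hx'L, hxx'⟩; rw [Option.some_inj] at hxx'; exact hxL (hxx' ▸ hx'L)
          have e2 : ¬ ∃ x' ∈ B, x' ∉ L ∧ some x = some x' := by
            rintro ⟨x', hx'B, -, hxx'⟩; rw [Option.some_inj] at hxx'; exact hxB (hxx' ▸ hx'B)
          rw [pickCount_eq_zero_of_not_mem hxB, if_neg e1, if_neg e2]
          simp
  refine (sum_le_sum fun o _ => hterm o).trans ?_
  rw [sum_add_distrib]
  -- count the outcomes of each kind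
  have hc1 : ∑ o : Option α, (if ∃ x ∈ L, o = some x then
      (D : ℝ) / L.length - D / B.length + 2 else 0) =
      L.length * ((D : ℝ) / L.length - D / B.length + 2) := by
    rw [← sum_filter, sum_const, nsmul_eq_mul]
    congr 1
    have : (univ.filter fun o : Option α => ∃ x ∈ L, o = some x) = L.toFinset.map
        (Function.Embedding.some) := by
      ext o
      simp only [mem_filter, mem_univ, true_and, mem_map, List.mem_toFinset,
        Function.Embedding.some_apply]
      constructor
      · rintro ⟨x, hx, rfl⟩; exact ⟨x, hx, rfl⟩
      · rintro ⟨x, hx, rfl⟩; exact ⟨x, hx, rfl⟩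
    rw [this, card_map, List.toFinset_card_of_nodup hLN]
  have hc2 : ∑ o : Option α, (if ∃ x ∈ B, x ∉ L ∧ o = some x then (D : ℝ) / B.length + 1 else 0) =
      (B.length - L.length : ℝ) * ((D : ℝ) / B.length + 1) := by
    rw [← sum_filter, sum_const, nsmul_eq_mul]
    congr 1
    have : (univ.filter fun o : Option α => ∃ x ∈ B, x ∉ L ∧ o = some x) =
        (B.toFinset \ L.toFinset).map (Function.Embedding.some) := by
      ext o
      simp only [mem_filter, mem_univ, true_and, mem_map, mem_sdiff, List.mem_toFinset,
        Function.Embedding.some_apply]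
      constructor
      · rintro ⟨x, hx, hxL, rfl⟩; exact ⟨x, ⟨hx, hxL⟩, rfl⟩
      · rintro ⟨x, ⟨hx, hxL⟩, rfl⟩; exact ⟨x, hx, hxL, rfl⟩
    rw [this, card_map, card_sdiff_of_subset (fun x hx => by
      rw [List.mem_toFinset] at hx ⊢; exact hLB x hx), List.toFinset_card_of_nodup hBN,
      List.toFinset_card_of_nodup hLN, Nat.cast_sub hLle]
  rw [hc1, hc2]
  -- algebra: `ℓ(D/ℓ - D/b + 2) + (b-ℓ)(D/b + 1) = 2D(1 - ℓ/b) + ℓ + b ≤ 2D(1-ℓ/b) + 2b`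
  have hkey : (L.length : ℝ) * ((D : ℝ) / L.length - D / B.length + 2) +
      (B.length - L.length : ℝ) * ((D : ℝ) / B.length + 1) =
      2 * D * (1 - (L.length : ℝ) / B.length) + L.length + B.length := by
    field_simp
    ring
  rw [hkey]
  linarith

/-- `pickCount` read with any decidability instance (the definition uses the classical one).
[folklore] -/
theorem pickCount_eq_card [DecidableEq α] (L : List α) (D : ℕ) (o : Option α) :
    pickCount L D o = (univ.filter fun u : Fin D => pick L u = o).card := by
  unfold pickCount
  congr

end BucketSelection

/-! ### The full bucket: `h`-averaged domination of the uniform law -/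

namespace AffineHash

open BucketSelection

variable {m k : ℕ}

/-- **Bucket-then-pick dominates the uniform law on `S`** (counting over the hash and the private
index): for `x ∈ S`, the pairs `(h, u) ∈ ℋ × {0,…,D-1}` for which picking from the full bucket
`S ∩ h⁻¹(y)` (listed in any fixed order) yields `x` number at least
`D|ℋ|/(2ᵏ + |S| - 1) - |ℋ|/2ᵏ`. [folklore] -/
theorem card_pick_targetBucket_ge (S : Finset (Fin m → ZMod 2)) {x : Fin m → ZMod 2} (hx : x ∈ S)
    (y : Fin k → ZMod 2) (D : ℕ) :
    (D : ℝ) * Fintype.card (Hash m k) / (2 ^ k + S.card - 1) - Fintype.card (Hash m k) / 2 ^ k ≤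
      ((univ.filter fun c : Hash m k × Fin D =>
        pick (targetBucket S c.1 y).toList c.2 = some x).card : ℝ) := by
  classical
  -- fibre over `h`: the count is `Σ_h pickCount (bucket_h) D (some x)`
  have hfib : ((univ.filter fun c : Hash m k × Fin D =>
      pick (targetBucket S c.1 y).toList c.2 = some x).card : ℝ) =
      ∑ h : Hash m k, (pickCount (targetBucket S h y).toList D (some x) : ℝ) := by
    rw [card_filter]
    push_cast
    rw [Fintype.sum_prod_type]
    refine sum_congr rfl fun h _ => ?_
    rw [pickCount, card_filter]
    push_cast
    rfl
  rw [hfib]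
  -- only hashes with `h(x) = y` contribute, each at least `D/|bucket| - 1`
  set T := univ.filter (fun h : Hash m k => hash h x = y) with hT
  have hsplit : ∑ h ∈ T, ((D : ℝ) / (targetBucket S h y).card - 1) ≤
      ∑ h : Hash m k, (pickCount (targetBucket S h y).toList D (some x) : ℝ) := by
    refine le_trans (sum_le_sum fun h hh => ?_)
      (sum_le_sum_of_subset_of_nonneg (filter_subset _ _) fun h _ _ => by positivity)
    have hxB : x ∈ (targetBucket S h y).toList := by
      rw [Finset.mem_toList, mem_filter]; exact ⟨hx, (mem_filter.1 hh).2⟩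
    have := le_pickCount (Finset.nodup_toList _) hxB D
    rwa [Finset.length_toList] at this
  refine le_trans ?_ hsplit
  rw [sum_sub_distrib, sum_const, nsmul_eq_mul, mul_one]
  have hTcard : (T.card : ℝ) = Fintype.card (Hash m k) / 2 ^ k := card_filter_hash_eq_real x y
  rw [hTcard]
  have hharm := sum_inv_card_targetBucket_ge (k := k) S hx y
  rw [← hT] at hharm
  have : ∑ h ∈ T, (D : ℝ) / (targetBucket S h y).card =
      D * ∑ h ∈ T, (1 : ℝ) / (targetBucket S h y).card := by
    rw [mul_sum]; refine sum_congr rfl fun h _ => ?_; rw [mul_one_div]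
  rw [this]
  have hD : (0 : ℝ) ≤ D := by positivity
  have := mul_le_mul_of_nonneg_left hharm hD
  rw [mul_div_assoc]
  linarith

/-- The same bound relative to the uniform benchmark `D|ℋ|/|S|`: with `μ = |S|/2ᵏ` the count is at
least `(1 - 1/μ - μ/D) · D|ℋ|/|S|`, written without divisions by `μ`:
`D|ℋ|/|S| - D|ℋ|2ᵏ/|S|² - |ℋ||S|/(2ᵏ |S|)`. [folklore] -/
theorem card_pick_targetBucket_ge' (S : Finset (Fin m → ZMod 2)) {x : Fin m → ZMod 2} (hx : x ∈ S)
    (y : Fin k → ZMod 2) (D : ℕ) :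
    (D : ℝ) * Fintype.card (Hash m k) / S.card * (1 - 2 ^ k / S.card - S.card / (D * 2 ^ k)) ≤
      ((univ.filter fun c : Hash m k × Fin D =>
        pick (targetBucket S c.1 y).toList c.2 = some x).card : ℝ) := by
  rcases Nat.eq_zero_or_pos D with rfl | hDpos
  · simp
  refine le_trans ?_ (card_pick_targetBucket_ge S hx y D)
  have hS : (1 : ℝ) ≤ S.card := by exact_mod_cast card_pos.2 ⟨x, hx⟩
  have hSpos : (0 : ℝ) < S.card := by linarith
  have hH : (0 : ℝ) < Fintype.card (Hash m k) := by exact_mod_cast Fintype.card_pos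
  have h2 : (0 : ℝ) < 2 ^ k := by positivity
  have h2k : (1 : ℝ) ≤ 2 ^ k := one_le_pow₀ (by norm_num)
  have hD : (0 : ℝ) < D := by exact_mod_cast hDpos
  have hden : (0 : ℝ) < 2 ^ k + S.card - 1 := by linarith
  have hDH : (0 : ℝ) ≤ (D : ℝ) * Fintype.card (Hash m k) := by positivity
  -- `(1 - 2ᵏ/s)(2ᵏ + s - 1) ≤ s`
  have hineq : ((S.card : ℝ) - 2 ^ k) * (2 ^ k + S.card - 1) ≤ (S.card : ℝ) * S.card := by
    nlinarith
  have hfrac : (1 - (2 : ℝ) ^ k / S.card) * (2 ^ k + S.card - 1) ≤ S.card := by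
    have : (1 - (2 : ℝ) ^ k / S.card) = ((S.card : ℝ) - 2 ^ k) / S.card := by
      field_simp
    rw [this, div_mul_eq_mul_div, div_le_iff₀ hSpos]
    exact hineq
  -- `D|ℋ|/|S| · (1 - 2ᵏ/|S|) ≤ D|ℋ|/(2ᵏ + |S| - 1)`
  have hmain : (D : ℝ) * Fintype.card (Hash m k) / S.card * (1 - 2 ^ k / S.card) ≤
      (D : ℝ) * Fintype.card (Hash m k) / (2 ^ k + S.card - 1) := by
    rw [div_mul_eq_mul_div, div_le_div_iff₀ hSpos hden]
    calc (D : ℝ) * Fintype.card (Hash m k) * (1 - 2 ^ k / S.card) * (2 ^ k + S.card - 1)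
        = (D : ℝ) * Fintype.card (Hash m k) * ((1 - 2 ^ k / S.card) * (2 ^ k + S.card - 1)) := by
          ring
      _ ≤ (D : ℝ) * Fintype.card (Hash m k) * S.card := mul_le_mul_of_nonneg_left hfrac hDH
  -- the last terms agree: `D|ℋ|/|S| · |S|/(D 2ᵏ) = |ℋ|/2ᵏ`
  have hlast : (D : ℝ) * Fintype.card (Hash m k) / S.card * (S.card / (D * 2 ^ k)) =
      Fintype.card (Hash m k) / 2 ^ k := by
    field_simp
  have hsplit : (D : ℝ) * Fintype.card (Hash m k) / S.card * (1 - 2 ^ k / S.card - S.card / (D * 2 ^ k))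
      = (D : ℝ) * Fintype.card (Hash m k) / S.card * (1 - 2 ^ k / S.card) -
          (D : ℝ) * Fintype.card (Hash m k) / S.card * (S.card / (D * 2 ^ k)) := by ring
  rw [hsplit, hlast]
  linarith

end AffineHash



end Literature.Computability.Complexity

end
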